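import Summits.CriticalPhenomena.Ising3DConformalLimit.Theorems.SubharmonicOffOrigin.Negative.AxisExactBalance
import Literature.Probability.LatticeModels.CriticalTwoPointLower
import Literature.Probability.LatticeModels.MessagerMiracleSole
import HarnessLib

/-!
# Unconditional exact balance of the critical 3-D Ising two-point function along an axis
# (crux `SubharmonicOffOrigin`, stmt-CriticalPhenomena-1341, route PerfectScreening; by-product of
# lead c1, STRATEGY-CENSUS.md §8 item 2 — helper `--supports`, not a proof of the crux)

Let `G = criticalTwoPoint 3 = ⟨σ₀σ_x⟩⁺_{β_c(3)}` and `M(n) = G(n e₀) > 0`. The tree file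
`…/SubharmonicOffOrigin/Negative/AxisExactBalance.lean` proves the UPPER half
`eventually_nbrSum_axis_lt`: eventually `∑_nbrs G(n e₀) < (6+ε) M(n)`, and derives the limit
`∑_nbrs G(n e₀) / M(n) → 6` only CONDITIONALLY on the crux `SubharmonicOffOrigin`.

Here the condition is removed. The LOWER half `eventually_lt_nbrSum_axis`
(eventually `(6−ε) M(n) < ∑_nbrs G(n e₀)`) follows from
* Messager–Miracle-Solé 1977 in DIAGONAL form (`messager_miracleSole_diag_holds`): for `j ≠ 0` and
  `n ≥ 1`, `M(n+1) = G((n e₀ + e_j) + e₀ − e_j) ≤ G(n e₀ + e_j)`;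
* reflection invariance (`twoPointPlus_reflection_invariant_holds`): `G(n e₀ − e_j) = G(n e₀ + e_j)`;
* the axis ratio regularity `M(n+1)/M(n) → 1` (`criticalTwoPoint_axis_ratio_tendsto_one`,
  Aizenman–Duminil-Copin 2021 log-convexity + Simon–Lieb lower bound),
so that `∑_nbrs G(n e₀) ≥ M(n−1) + 5 M(n+1)` with `(M(n−1) + 5 M(n+1))/M(n) → 6`. Together with the
tree's upper half, `tendsto_nbrSum_div_axis`: `∑_nbrs G(n e₀) / G(n e₀) → 6` unconditionally.

References: A. Messager, S. Miracle-Solé, J. Stat. Phys. 17 (1977) 245; G. C. Hegerfeldt, CMP 57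
(1977) 259; M. Aizenman, H. Duminil-Copin, Ann. of Math. 194 (2021); B. Simon, CMP 77 (1980).
-/

noncomputable section

open Filter Topology Finset
open Literature.Probability.LatticeModels
open Summit.CriticalPhenomena.Ising3DConformalLimit.SubharmonicOffOriginAxisBalance

namespace Summit.CriticalPhenomena.Ising3DConformalLimit.Theorems.PerfectScreening.AxisBalance

/-! ### Site bookkeeping -/

/-- Axis bookkeeping: `(n e₀ + e_j) + e₀ − e_j = (n+1) e₀`. [folklore] -/
theorem transverse_add_shift (n : ℕ) (j : Fin 3) :
    (Pi.single 0 (n : ℤ) + Pi.single j 1 + Pi.single 0 1 - Pi.single j 1 : Site 3) =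
      Pi.single 0 ((n + 1 : ℕ) : ℤ) := by
  rw [add_right_comm, add_sub_cancel_right, axis_add_one]

/-- Axis bookkeeping: reflecting the `j`-th coordinate (`j ≠ 0`) of `n e₀ + e_j` gives `n e₀ − e_j`.
[folklore] -/
theorem update_transverse_add (n : ℕ) {j : Fin 3} (hj : j ≠ 0) :
    Function.update (Pi.single 0 (n : ℤ) + Pi.single j 1 : Site 3) j
        (-(Pi.single 0 (n : ℤ) + Pi.single j 1 : Site 3) j) =
      (Pi.single 0 (n : ℤ) - Pi.single j 1 : Site 3) := by
  funext k
  by_cases hk : k = j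
  · subst hk
    simp [hj]
  · simp [hk]

/-! ### The two correlation-inequality inputs on the transverse neighbours -/

/-- **Messager–Miracle-Solé 1977 (diagonal reflection), on the axis**: for `j ≠ 0` and `n ≥ 1`,
`G((n+1) e₀) ≤ G(n e₀ + e_j)` — apply `messager_miracleSole_diag_holds` at `x = n e₀ + e_j` with
`i = 0`, where `x_j = 1 ≤ n = x_0`, and note `x + e₀ − e_j = (n+1) e₀`. [folklore] -/
theorem axis_succ_le_transverse_add {n : ℕ} (hn : 1 ≤ n) {j : Fin 3} (hj : j ≠ 0) :
    criticalTwoPoint 3 (Pi.single 0 ((n + 1 : ℕ) : ℤ)) ≤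
      criticalTwoPoint 3 (Pi.single 0 (n : ℤ) + Pi.single j 1) := by
  have hx : (Pi.single 0 (n : ℤ) + Pi.single j 1 : Site 3) j ≤
      (Pi.single 0 (n : ℤ) + Pi.single j 1 : Site 3) 0 := by
    simp [hj, hn]
  have h := messager_miracleSole_diag_holds (d := 3) (β := criticalBeta 3) (criticalBeta_nonneg 3)
    (Pi.single 0 (n : ℤ) + Pi.single j 1) hj.symm hx
  rw [transverse_add_shift] at h
  exact h

/-- **Reflection symmetry on the axis**: for `j ≠ 0`, `G(n e₀ − e_j) = G(n e₀ + e_j)`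
(`twoPointPlus_reflection_invariant_holds`, reflection `x_j ↦ −x_j`). [folklore] -/
theorem transverse_sub_eq_add (n : ℕ) {j : Fin 3} (hj : j ≠ 0) :
    criticalTwoPoint 3 (Pi.single 0 (n : ℤ) - Pi.single j 1) =
      criticalTwoPoint 3 (Pi.single 0 (n : ℤ) + Pi.single j 1) := by
  have h := twoPointPlus_reflection_invariant_holds (d := 3) (criticalBeta_nonneg 3) j
    (Pi.single 0 (n : ℤ) + Pi.single j 1 : Site 3)
  rw [update_transverse_add n hj] at h
  exact h

/-- The four transverse neighbours of `n e₀` (`n ≥ 1`) dominate the next axis value: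
`G((n+1) e₀) ≤ G(n e₀ ± e₁), G(n e₀ ± e₂)` (Messager–Miracle-Solé 1977 + reflection symmetry).
[folklore] -/
theorem axis_succ_le_transverse_nbrs (n : ℕ) (hn : 1 ≤ n) :
    criticalTwoPoint 3 (Pi.single 0 ((n + 1 : ℕ) : ℤ)) ≤
        criticalTwoPoint 3 (Pi.single 0 (n : ℤ) + Pi.single 1 1) ∧
    criticalTwoPoint 3 (Pi.single 0 ((n + 1 : ℕ) : ℤ)) ≤
        criticalTwoPoint 3 (Pi.single 0 (n : ℤ) - Pi.single 1 1) ∧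
    criticalTwoPoint 3 (Pi.single 0 ((n + 1 : ℕ) : ℤ)) ≤
        criticalTwoPoint 3 (Pi.single 0 (n : ℤ) + Pi.single 2 1) ∧
    criticalTwoPoint 3 (Pi.single 0 ((n + 1 : ℕ) : ℤ)) ≤
        criticalTwoPoint 3 (Pi.single 0 (n : ℤ) - Pi.single 2 1) := by
  have h1 : (1 : Fin 3) ≠ 0 := by decide
  have h2 : (2 : Fin 3) ≠ 0 := by decide
  refine ⟨axis_succ_le_transverse_add hn h1, ?_, axis_succ_le_transverse_add hn h2, ?_⟩
  · rw [transverse_sub_eq_add n h1]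
    exact axis_succ_le_transverse_add hn h1
  · rw [transverse_sub_eq_add n h2]
    exact axis_succ_le_transverse_add hn h2

/-! ### The lower half of exact balance, and the unconditional limit -/

/-- **Exact balance on the axis, lower half (unconditional).** For every `ε > 0`, eventually in `n`,
`(6 − ε) G(n e₀) < ∑ᵢ (G(n e₀ + eᵢ) + G(n e₀ − eᵢ))`: the axial neighbours contribute
`G((n−1) e₀) + G((n+1) e₀)`, each of the four transverse ones is `≥ G((n+1) e₀)`
(Messager–Miracle-Solé 1977, diagonal form, + reflection symmetry), and
`G((n±1)e₀)/G(n e₀) → 1` (`criticalTwoPoint_axis_ratio_tendsto_one`), so the sum is eventually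
`≥ G((n−1)e₀) + 5 G((n+1)e₀) > (6 − ε) G(n e₀)`. [folklore] -/
theorem eventually_lt_nbrSum_axis (ε : ℝ) (hε : 0 < ε) :
    ∀ᶠ n : ℕ in atTop,
      (6 - ε) * criticalTwoPoint 3 (Pi.single 0 (n : ℤ)) <
        ∑ i : Fin 3, (criticalTwoPoint 3 (Pi.single 0 (n : ℤ) + Pi.single i 1) +
          criticalTwoPoint 3 (Pi.single 0 (n : ℤ) - Pi.single i 1)) := by
  set M : ℕ → ℝ := fun n => criticalTwoPoint 3 (Pi.single 0 (n : ℤ))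
  have hpos : ∀ n, 0 < M n := criticalTwoPoint_axis_pos
  have hr : Tendsto (fun k : ℕ => M (k + 2) / M (k + 1)) atTop (𝓝 1) :=
    criticalTwoPoint_axis_ratio_tendsto_one (0 : Fin 3)
  have hrinv : Tendsto (fun k : ℕ => M (k + 1) / M (k + 2)) atTop (𝓝 1) := by
    have h := hr.inv₀ one_ne_zero
    rw [inv_one] at h
    refine h.congr fun k => ?_
    rw [inv_div]
  have hr' : Tendsto (fun k : ℕ => M (k + 3) / M (k + 2)) atTop (𝓝 1) :=
    hr.comp (tendsto_add_atTop_nat 1)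
  have hsum : Tendsto (fun k : ℕ => M (k + 1) / M (k + 2) + 5 * (M (k + 3) / M (k + 2))) atTop
      (𝓝 (1 + 5 * 1)) :=
    hrinv.add (hr'.const_mul 5)
  have hev : ∀ᶠ k : ℕ in atTop, 6 - ε < M (k + 1) / M (k + 2) + 5 * (M (k + 3) / M (k + 2)) :=
    hsum.eventually (eventually_gt_nhds (by linarith))
  rw [eventually_atTop] at hev ⊢
  obtain ⟨K, hK⟩ := hev
  refine ⟨K + 2, fun n hn => ?_⟩
  obtain ⟨k, rfl⟩ : ∃ k, n = k + 2 := ⟨n - 2, by omega⟩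
  have hk := hK k (by omega)
  have hM2 : 0 < M (k + 2) := hpos (k + 2)
  have hfrac : (6 - ε) * M (k + 2) < M (k + 1) + 5 * M (k + 3) := by
    rw [← mul_div_assoc, ← add_div, lt_div_iff₀ hM2] at hk
    exact hk
  obtain ⟨t1, t2, t3, t4⟩ := axis_succ_le_transverse_nbrs (k + 2) (by omega)
  change M (k + 3) ≤ _ at t1 t2 t3 t4
  have hax1 : (Pi.single 0 ((k + 2 : ℕ) : ℤ) + Pi.single 0 1 : Site 3) =
      Pi.single 0 ((k + 3 : ℕ) : ℤ) :=
    axis_add_one (k + 2)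
  have hax2 : (Pi.single 0 ((k + 2 : ℕ) : ℤ) - Pi.single 0 1 : Site 3) =
      Pi.single 0 ((k + 1 : ℕ) : ℤ) :=
    axis_sub_one (k + 1)
  rw [Fin.sum_univ_three, hax1, hax2]
  change (6 - ε) * M (k + 2) < M (k + 3) + M (k + 1) + _ + _
  linarith [t1, t2, t3, t4, hfrac]

/-- **Unconditional axis exact balance of the critical 3-D Ising two-point function**:
`∑ᵢ (G(n e₀ + eᵢ) + G(n e₀ − eᵢ)) / G(n e₀) → 6` as `n → ∞`, i.e. `ΔG/G → 0` along the axis, for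
`G = ⟨σ₀σ_x⟩⁺_{β_c(3)}` — from the lower half `eventually_lt_nbrSum_axis` (Messager–Miracle-Solé 1977
in diagonal form + reflection symmetry + axis ratio regularity) and the tree's upper half
`eventually_nbrSum_axis_lt`. This removes the hypothesis `SubharmonicOffOrigin` from
`tendsto_nbrSum_div_of_subharmonicOffOrigin`. [folklore] -/
theorem tendsto_nbrSum_div_axis : Tendsto (fun n : ℕ => (∑ i : Fin 3, (criticalTwoPoint 3 (Pi.single 0 (n : ℤ) + Pi.single i 1) + criticalTwoPoint 3 (Pi.single 0 (n : ℤ) - Pi.single i 1))) / criticalTwoPoint 3 (Pi.single 0 (n : ℤ))) atTop (𝓝 6) := by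
  have hpos : ∀ n : ℕ, 0 < criticalTwoPoint 3 (Pi.single 0 (n : ℤ)) := criticalTwoPoint_axis_pos
  rw [tendsto_order]
  refine ⟨fun a ha => ?_, fun b hb => ?_⟩
  · filter_upwards [eventually_lt_nbrSum_axis (6 - a) (by linarith)] with n hn
    rw [lt_div_iff₀ (hpos n)]
    linarith
  · filter_upwards [eventually_nbrSum_axis_lt (b - 6) (by linarith)] with n hn
    rw [div_lt_iff₀ (hpos n)]
    linarith

end Summit.CriticalPhenomena.Ising3DConformalLimit.Theorems.PerfectScreening.AxisBalance

end
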